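import Mathlib
import Literature.NumberTheory.EllipticCurves.KuriharaNumber
import Literature.NumberTheory.EllipticCurves.KatoKolyvaginPrimes
import Literature.NumberTheory.EllipticCurves.CuspFormLFunction
import Literature.NumberTheory.EllipticCurves.KuriharaNumberKimCertificate
import Literature.NumberTheory.EllipticCurves.BSDSelmer
import Literature.NumberTheory.EllipticCurves.NonEisensteinPrimeOfSurjective
import HarnessLib

/-!
# KuriharaNumberKimStructure

Topic `Literature/NumberTheory/EllipticCurves`. Named literature fact(s) relocated by the gate from `Summits/BirchSwinnertonDyer/BirchSwinnertonDyer/Theorems/SelmerRankSelmerRankLBStubDeltaPrime.lean`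
(accept-time relocation of `[cite]`d propositions written inline in a Summits proposal; human ruling 2026-08-15).
Sources: AbbesUllmo1996, BurungaleEtAl2026, Kim2022StructureSelmer, YanZhu2024MainConjNonCM.

* `Literature.NumberTheory.EllipticCurves.Kim2022_selmerCorank_le_of_kuriharaNumber_ne_zero`
* `Literature.NumberTheory.EllipticCurves.yanZhu_analyticRank_eq_one_of_selmerCorank_eq_one`

CAVEAT on `Kim2022_selmerCorank_le_of_kuriharaNumber_ne_zero` (literature-prover, 2026-08-17): the
fact quantifies over Kim's LITERAL `𝒩_k` (square-free products of primes `ℓ ∤ Np` with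
`ℓ ≡ 1`, `a_ℓ ≡ ℓ + 1 (mod p^k)`, = `Kato.IsKolyvaginProduct`), but the printed proof — and the
sets of Kurihara and of Mazur–Rubin it rests on — also require `Ẽ(𝔽_ℓ)[p^k] ≅ ℤ/p^k`, i.e.
`Ẽ(𝔽_ℓ)[p]` cyclic, for every `ℓ ∣ n`; at levels containing a prime that splits completely in
`ℚ(E[p])` the statement is stronger than what the source proves. The statement the source does
prove is spelled out (as the conclusion of the trivial implication from the literal one) in
`Kim2022_selmerCorank_le_of_kuriharaNumber_ne_zero_cyclicLevel_of` below; see its docstring for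
the sources. Prefer that form downstream.

NUMBERING NOTE for `Kim2022StructureSelmer` (literature-prover, 2026-08-18; docstring-only): the
locators "Thm. 1.9", "Thm. 1.11", "Cor. 1.12–1.14", "Thm. 1.16" and the "PDF p." pages used in this
file and in its siblings (`KuriharaNumberKimCertificate`, `KuriharaNumberKimModP`,
`KuriharaNumberKimNonvanishing`, `MazurTateElementKuriharaCoefficient`, `KatoKolyvaginPrimes`, the
`…Proofs` files) are those of the arXiv v3/v4 text of arXiv:2203.12159 (2022–2023; the store copy).
The FINAL version — arXiv v5/v6 (2025, "Final version. To appear in American Journal of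
Mathematics") = Amer. J. Math. 148 (2026), no. 1, 79–129, doi:10.1353/ajm.2026.a980769 — drops the
old Cor. 1.7 and renumbers §1 (checked on the TeX sources with the shared `\newtheorem` counter):
Thm. 1.9 → **1.8** (structure theorem), Conj. 1.10 → 1.9, Thm. 1.11 → **1.10**, Cor. 1.12 → 1.11,
Cor. 1.13 → 1.12, Cor. 1.14 → **1.13**, Conj. 1.15 → 1.14, Thm. 1.16 → 1.15; Thm. 1.1–1.4 and
Cor. 1.5–1.6 keep their numbers, and the STATEMENTS of Cor. 1.5, Cor. 1.6 and of the structure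
theorem are byte-identical between v4 and v6 (only the headline Thm. 1.1 lost two footnotes and the
Manin remark now reads "The Manin constant assumption becomes vacuous when E has semi-stable
reduction at p [Mazur, Cor. 4.1]"). No statement in the tree is affected; cite the final version as
"Thm. 1.8 (= Thm. 1.9 of arXiv v3/v4)" etc. (v1/v2 not checked).

NUMBERING NOTE, SUPPLEMENT (literature-prover, n1011-lit GEN 8, 2026-08-21; docstring-only; read from
the arXiv TeX sources of ALL six versions v1 (2022-03-23), v2, v3 (2022-04-06), v4 (2023-09-22), v5,
v6 (2025-05-14), numbered mechanically from the shared counter; full table and verbatim quotes in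
`run/shared/lean/b2b/bsd-rank1-residual/cells/n1011/LIT-INPUTS-P3.md` §56). (a) The store copy's
numbering is that of v1 = v2 = v3 for EVERY environment of §§1–8; "v3/v4" above is right for §1 only:
v4 already renumbers §§2–5 and keeps §1, v5/v6 renumber §1 as listed above (add Conj. 1.8 → 1.7;
Conj. 1.17 (BSD), Conj. 1.18 (MTT) are no longer numbered environments; Question 1.19 → 1.16). So a
tree locator of the shape "arXiv v4 … Lemma 3.10 / Thm. 3.13 / Def. 2.13 / Thm. 2.14 / Prop. 3.2 /
Remark 3.8" quotes v≤3 numbers (v4 prints 3.9 / 3.11 / 2.13 / 2.14 / 3.1 / 3.7); harmless. (b) JOURNAL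
(= v6; Crossref record of doi:10.1353/ajm.2026.a980769 carries v6's abstract) numbers for the §§2–7
locators used in the tree, store (v1–v3) → journal: §2: Thm. 2.1 = 2.1; Prop. 2.2 (infinitely many
useful primes) → 2.3; Prop. 2.3 (Chebotarev, = Mazur–Rubin Prop. 3.6.1) → **2.2**; Thm. 2.4 (core
rank) → 2.5; Thm. 2.5 → 2.6; Thm. 2.6 (stub) → 2.7; Rem. 2.7 → 2.8; Prop. 2.8 (location) → 2.9;
Cor. 2.9 → absent; Lemma 2.10 (surjectivity at `ℓ`) → **Lemma 2.4** (restated for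
`𝓕 ∈ {𝓕_cl, 𝓕_can}`); Prop. 2.11 → 2.10; Thm. 2.12 → 2.11; Def. 2.13 → **2.12**; Thm. 2.14 →
**2.13**; Cor. 2.15 → 2.14. §3: Prop. 3.1, Prop. 3.3, Rem. 3.6, Lemma 3.11 → absent; Prop. 3.2
(`E(ℚ_p)[p] ≠ 0` trichotomy; journal adds "odd prime", clauses unchanged) → **3.1**; Lemma 3.4 → 3.3;
Cor. 3.5 → 3.4; Thm. 3.7 (Tate's algorithm) → 3.6; Rem. 3.8 → **3.7** (the sentence "When `E` has
additive reduction at `p` with `p ≤ 3`, then `[E(ℚ_p):E₀(ℚ_p)]` is not divisible by `p`" is UNCHANGED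
in the journal); Lemma 3.9 → 3.8; Lemma 3.10 (additive dual exponential, "`p ≥ 3`") → **3.9**;
Prop. 3.12 → 3.10; Thm. 3.13 ("Kolyvagin derivatives" of Kato's explicit reciprocity law) → **3.11**;
Lemma 3.14 → 3.12; Prop. 3.15 → 3.13; Prop. 3.16 → 3.14; new in the journal: Rem. 3.2, Rem. 3.5.
§4: Lemma 4.1 = 4.1; Rem. 4.2 → absent; Thm. 4.3 → 4.2; Lemma 4.4 → 4.3; Thm. 4.5 (Kato–Rohrlich)
→ 4.4; Thm. 4.6 (Kato) → 4.5; Thm. 4.7 (Mazur–Rubin) → 4.6; Prop. 4.8 → 4.7; Cor. 4.9 → 4.8;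
Cor. 4.10 → 4.9; Prop. 4.11 → 4.10; Lemma 4.12 → 4.11. §5 is REWRITTEN: store §5 = Lemma 5.1 …
Notation 5.14; journal §5 = Thm. 5.1 [Flach, Howard] (= store Thm. 5.2), Prop. 5.2 (= store Prop.
5.5, with "`ρ̄` surjective" dropped from its hypotheses), Lemma 5.3 (new), Thm. 5.4 [Gross–Zagier,
Kolyvagin, Kato]; store **Thm. 5.6** ("`p^t·δ̃₁ ≠ 0 ⟺ Sel(ℚ, E[p^∞])` finite", cited by
`KuriharaNumberKimStructureProofs`) has NO journal number (journal §5.3.1, prose); store Lemma 5.12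
/ Prop. 5.13 → absorbed in journal §5.3–5.4. §§6–7 unchanged (Thm. 6.1, Rem. 6.2, Cor. 6.3, Prop.
7.1). Sub-subsections: store §1.2.5 (the "`p ≥ 5` only for the Chebotarev density type argument …
it seems possible to extend to the `p = 3` case following … Sakamoto [Appendix]" sentence) → journal
**§2.4.1**, REWORDED: "When we work with Kolyvagin systems, we always assume that `p ≥ 5` and `ρ̄`
is surjective. This is strong enough to satisfy all the working hypotheses for the theory of
Kolyvagin systems [MR, §3.5 and Lem. 6.2.3]. More precisely, the `p ≥ 5` condition is used only in
Proposition 2.2 below and its consequences. The `p=3` case is studied by Sakamoto recently [Sak24]"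
with [Sak24] = R. Sakamoto, J. Théor. Nombres Bordeaux 36 (2024) 919–946; store §1.3.5 (the Manin
sentence) → journal §1.4.1 as quoted above; store §2.1.7 → journal §2.1.6; §§1.2.2, 1.4.1–1.4.4,
1.5.1–1.5.3, 2.1.6, 2.2.2–2.2.3, 2.3.1, 2.4.2, 3.2.1–3.2.3, 3.4.1, 3.5, 6, 8 keep their numbers.
(c) Statements diffed store-vs-journal and found IDENTICAL: the structure theorem (journal Thm. 1.8),
Lemma 3.3/3.8/3.9 (journal), Thm. 3.11 (journal; punctuation only), Thms. 2.5–2.7 (journal), Rem.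
6.2. Convention unchanged: a bare locator in a `[cite: Kim2022StructureSelmer, …]` tag is the store
(arXiv v1–v3) number; write "(journal)" when the AJM number is meant. No statement in the tree is
affected by this supplement.

DISCREPANCY NOTE, SUPPLEMENT (literature-prover, n1011-lit GEN 11, 2026-08-21; docstring-only; located
print for the CAVEAT above and for the docstring of
`Kim2022_selmerCorank_le_of_kuriharaNumber_ne_zero_cyclicLevel_of`; page/line locators are those of
the store texts; full quotations in `run/shared/lean/b2b/bsd-rank1-residual/cells/n1011/LIT-INPUTS-P3.md`
§66 (A)). (a) The PLAIN set (no cyclicity clause) is also the printed convention of: C.-H. Kim–M. Kim–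
H.-S. Sun, Selecta Math. 26 (2020) = arXiv:1709.05780, Def. 4.1 ("Kolyvagin primes": `ρ` unramified
at `ℓ`, `ℓ ≡ 1`, `a_ℓ(f) ≡ ℓ + 1`, `ψ(ℓ) ≡ 1 (mod λ)`; store p. 12) together with its Lemma 4.6 (i)
"`T_f(1)/(Fr_ℓ - 1)T_f(1)` is a cyclic `ℤ_{f,λ}`-module for every `ℓ ∈ 𝒫`" (store p. 12; proof
"See [rubin-book]") and "Due to Lemma 4.6, we can omit the conditions on `𝒫` in [mazur-rubin-book]"
(store p. 13) — whereas the same paper's Def. 4.8 takes Mazur–Rubin's `𝒫_k` WITH the clause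
"`T_f(1)/(λ^k T_f(1) + (Fr_ℓ - 1)T_f(1))` is free of rank one"; of C.-H. Kim, *The refined Tamagawa
number conjectures for GL₂*, arXiv:2505.09121, §1.1.2 (store p. 4); and of F. Castella–T. Sano, *On
refined nonvanishing conjectures by Kurihara and Kolyvagin*, arXiv:2601.14504 (2026), §1.1.1 (the set
`𝓛`, store p. 3; `𝓜_r` = minimum over `ν(n) = r`). At a good prime `ℓ` whose Frobenius is trivial on
`E[p]` Lemma 4.6 (i) of Kim–Kim–Sun and the sentence "Under our working hypotheses, all the conditions
in Theorem 2.1 are satisfied" of Kim (§2.2.3, store p. 12) fail as printed (see THE DISCREPANCY in the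
docstring below), and for `ℓ ∈ 𝒫_k` the finite-singular comparison map `φ^{fs}_ℓ = Q_ℓ(Fr_ℓ⁻¹)`
(Kim §2.2.1, store p. 11; `P_ℓ(x) = 1 - a_ℓ x + ℓ x² ≡ (1 - x)² (mod p^k)`, `Q_ℓ(x) ≡ ±(x - 1)`) is
`±(Fr_ℓ⁻¹ - 1)`: an isomorphism iff `Ẽ(𝔽_ℓ)[p]` is cyclic (K. Rubin, *Euler systems and Kolyvagin
systems*, IAS/Park City Math. Ser. 18 (2011), Exercise 1.9.7 = Mazur–Rubin Lemma 1.2.3, p. 15) and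
ZERO on `E[p]` iff `Fr_ℓ = 1` on `E[p]`. (b) The CYCLIC convention is printed, besides Kurihara
(§1.2, store p. 3: "`𝒫_1^{(N)} = {ℓ ∈ 𝒫^{(N)} | H⁰(𝔽_ℓ, E[p^N]) ≃ ℤ/p^N}` … Conjecture 1.2.1. There
is `m ∈ 𝒩_1^{(N)}` such that `δ̃_m` is a unit"; §3.1, store p. 11, where the totally split primes
`(𝒫'_0)^{(N)}` are kept DISJOINT from `𝒫_1^{(N)}` and serve only as auxiliary primes of the
Gauss-sum-type Kolyvagin systems) and Mazur–Rubin, in: R. Sakamoto, *p-Selmer group and modular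
symbols*, Doc. Math. 27 (2022) 1891–1922 = arXiv:2106.03370, p. 3 ("Let `𝒫_{1,0}` denote the set
of Kolyvagin primes, that is, `𝒫_{1,0} := {ℓ ∉ S_bad(E) | E(𝔽_ℓ)[p] ≅ 𝔽_p and ℓ ≡ 1 (mod p)}`",
Kurihara's Conjecture 1.1 stated over `𝒩_{1,0}`) and p. 7 ("`𝒫_{m,n} := {ℓ | E(𝔽_ℓ)[p^m] ≅ ℤ/p^m
and ℓ ≡ 1 (mod p^{max{m,n+1}})}`. For any prime `ℓ ∈ 𝒫_{m,n}`, … `T/(Fr_ℓ - 1)T` is free of rank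
1"); Rubin (2011), Def. 2.1.3, p. 17 ("`𝒫 = {ℓ ∉ Σ : ℓ ≡ 1 (mod p^m)` and `A/(Fr_ℓ - 1)A` is free
of rank 1 over `R}`"). (c) Status: whether Kim's Thm. 1.9 (journal Thm. 1.8) is INTENDED over the
plain `𝒩_k` (with an argument for the levels containing a totally split prime, which the printed
proofs never form) or over the cyclic levels is recorded by the n1011 cell as author-query candidate
AQ-8 (`cells/n1011/AUTHOR-QUERIES.md`); the cell's numerical evidence (Kurihara numbers `≡ 0 (mod 3)`
at all 2 072 tested levels containing a prime split in `ℚ(E[3])`) is consistent with "plain minima =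
cyclic minima" but is EVIDENCE, not a theorem. Nothing in this supplement changes a statement;
prefer `…_cyclicLevel_of` downstream, as before.
-/

namespace Literature.NumberTheory.EllipticCurves

open scoped MatrixGroups ModularForm Classical
open CongruenceSubgroup
open Literature.NumberTheory.EllipticCurves
open Literature.NumberTheory.EllipticCurves.ModularForms

/-- **Kim's structure theorem, corank clause, UPPER direction, in the tree's normalisation**
(C.-H. Kim, *The structure of Selmer groups …*, arXiv:2203.12159 = Amer. J. Math. (2026),
doi:10.1353/ajm.2026.a980769, **Theorem 1.9 (1)**, PDF p. 7: "Let `E` be an elliptic curve over `ℚ`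
and `p ≥ 5` a prime such that `ρ̄` is surjective and the Manin constant is prime to `p`. If
`ord(δ̃) < ∞`, then (1) `cork_{ℤ_p} Sel(ℚ, E[p^∞]) = ord(δ̃)`", with §1.4.4
"`ord(δ̃) = min{ν(n) : n ∈ 𝒩_1, δ̃_n ≠ 0}`" and §1.4.3 "When `n ∈ 𝒩_k`, we write
`δ̃_n^{(k)} = δ̃_n mod p^k ∈ ℤ/p^kℤ`"). Since `I_n ⊆ p^kℤ_p` for `n ∈ 𝒩_k`, a non-zero `δ̃_n^{(k)}`
gives `δ̃_n ≠ 0 (mod I_n)`, so `ord(δ̃) ≤ ν(n) < ∞` is witnessed by `n` and (1) reads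
`cork_{ℤ_p} Sel_{p^∞}(E/ℚ) ≤ ν(n)` (a theorem as printed: the Iwasawa-theoretic input behind the
paper's Cor. 1.6 serves only the finiteness `ord(δ̃) < ∞`, which is free here).
Tree form: `W` a globally minimal model of `E`, `p ≥ 5` of good reduction with `p ∤ a_p` (kept to
match crux `SelmerRankLB`; only `p ∤ N` is used, for the Manin hypothesis: Abbes–Ullmo 1996 Thm. A
for the optimal curve, tree fact `abbesUllmo_not_dvd_maninConstant_of_not_dvd_level`, and an
isogeny to `E` of degree prime to `p`, which exists as `E[p]` is irreducible), `ρ̄_{E,p}` onto;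
`f` the newform of `W` (`IsNewformOf`, any level `N`, `= N_E` by Carayol); the EXPLICIT period
transfer `Ω(W) = u·Ω⁺_f`, `u ∈ ℚ`, `|u|_p = 1` (Kim's `[r]⁺ = Re{∞,r}/Ω⁺_E`, Néron period of the
minimal model = `W.realPeriodRat`; the tree's `ratPlusSymbol f r = Re{∞,r}/Ω⁺_f`; so
`kuriharaNumber f (p^k) n ψ = ū·δ̃_n^{(k)}`, `ū` a unit — the normalisation clause of
`Kim2022_kuriharaNumber_certificate`); `k ≥ 1`, `n ∈ 𝒩_k` (`Kato.IsKolyvaginProduct W p k n`: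
square-free, `ℓ ∤ N_E p`, `ℓ ≡ 1`, `a_ℓ ≡ ℓ + 1 (mod p^k)`); surjective discrete logarithms
`ψ_ℓ : (ℤ/ℓ)ˣ → ℤ/p^k` (Kim's `log_{η_ℓ} mod p^k`; the choice changes `δ` by a unit,
`kuriharaNumber_eq_zero_iff_of_surjective`). Conclusion: `kuriharaNumber f (p^k) n ψ ≠ 0 ⇒
corank_{ℤ_p} Sel_{p^∞}(E/ℚ) = W.selmerCorank p ≤ ν(n) = #primeFactors n`. Weaker than print.
**FLAG `K26-(6)-shallow@t>0`** — B1 instance, `k = 1` certificates at anomalous `p` (ARM P D-audit,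
reader bsd-cited-r10, sheet `D-AUDIT-r10.md` sha16 cfa522325b7b7321 §D.2 F2 with its ADDENDUM-1 sha16
463fcb17390e3a71 §A3 — journal text AJM 148 = arXiv v6 read, scope addition "B1 is F2-exposed too",
2026-08-26; STRONGER-THAN-PROOF ⇒ narrow; typer bsd-cited-ty2, TY-QUEUE 11b): with
`t := ord_p #E(ℚ_p)[p^∞]`, the refereed proof computes
`cork_{ℤ_p} Sel(ℚ, E[p^∞]) = ord(loc^s_p κ^Kato) = ord(p^t · δ̃)` at DEEP levels (journal §5.3.2
"Let `k ≫ 0`", §5.3.3–5.3.4; Thm. 3.13 = journal Thm. 3.11: `x_n = u · p^t · δ̃_n ∈ ℤ/p^{k(n)}`) and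
passes to `= ord(δ̃)` by journal Lemma 3.12 ("`ord(p^t·δ̃) = ord(δ̃)` … can be checked directly",
not displayed; v6 PDF p. 21; the choice of `n` in §5.4.1, PDF p. 30, and "since `k ≫ 0`" in
§5.3.3–5.3.4, PDF p. 29, are the other loci — ADDENDUM-1 §A2); so on a `t ≥ 1` row — at the good
ordinary `p` of this statement: `a_p ≡ 1 (mod p)` AND `E(ℚ_p)` has a point of order `p` (Prop. 3.2
= journal Prop. 3.1) — a certificate
`δ̃_n^{(k)} ≠ 0` of depth `k ≤ t` (in particular the LEVEL-ONE certificates `k = 1` consumed under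
`Summits/` and by `Kim2026.rank_eq_card_primeFactors_of_kuriharaNumber_ne_zero`) is not covered by
the displayed argument; at `t = 0` it is (`p^0 = 1`). PROOF-COVERED TWIN:
`Kim2022_selmerCorank_le_of_kuriharaNumber_ne_zero_of_localTorsionTrivial` below (one extra binder
`#E(ℚ_p)[p] = 1`; bridge `…_of_localTorsionTrivial_of` proved); this decl is KEPT byte-identical for
its importers. (Independent of the CAVEAT on cyclic levels above, which concerns the level set.)
[cite: Kim2022StructureSelmer, Thm. 1.9 (1) (PDF p. 7), §1.4.1–1.4.4 (PDF p. 7)]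
[cite: AbbesUllmo1996, Thm. A]
[file NumberTheory/EllipticCurves/KuriharaNumberKimStructure] -/
def Kim2022_selmerCorank_le_of_kuriharaNumber_ne_zero : Prop :=
  ∀ (W : WeierstrassCurve ℚ) [W.IsElliptic] [W.IsGloballyMinimal] (p : ℕ) [Fact p.Prime],
    5 ≤ p → W.HasGoodReductionAtPrime p → ¬ (p : ℤ) ∣ W.frobeniusTrace p →
    W.HasSurjectiveModNGaloisRep p →
    ∀ {N : ℕ} [NeZero N] (f : CuspForm (CongruenceSubgroup.Gamma0 N) 2),
    Literature.NumberTheory.EllipticCurves.ModularForms.IsNewformOf W f →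
    (∃ u : ℚ, ‖(u : ℚ_[p])‖ = 1 ∧
      W.realPeriodRat = u * Literature.NumberTheory.EllipticCurves.ModularForms.plusPeriod f) →
    ∀ (k n : ℕ) [NeZero n], 1 ≤ k →
    Literature.NumberTheory.EllipticCurves.Kato.IsKolyvaginProduct W p k n →
    ∀ ψ : (ℓ : ℕ) → (ZMod ℓ)ˣ →* Multiplicative (ZMod (p ^ k)),
      (∀ ℓ ∈ n.primeFactors, Function.Surjective (ψ ℓ)) →
      Literature.NumberTheory.EllipticCurves.kuriharaNumber f (p ^ k) n ψ ≠ 0 →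
      W.selmerCorank p ≤ n.primeFactors.card

/-- **The corank-one `p`-converse at a good ordinary prime, without ramification hypothesis**
(X. Yan, X. Zhu, arXiv:2412.20078 = J. Algebra (2026), doi:10.1016/j.jalgebra.2026.01.016 — on
non-CM elliptic curves at good ordinary primes — **Corollary 1.4** (§1.1, p. 3 of the held text;
= Thm. 4.15 of §4.6), verbatim: "Let `E/ℚ` be an elliptic curve of conductor `N`, `p ∤ 2N` a prime.
Assume that `E` has ordinary reduction at `p`, if `r ≤ 1`, the following are equivalent
• `corank_{ℤ_p} Sel_{p^∞}(E/ℚ) = r`, • `ord_{s=1} L(E/ℚ, s) = r`", under the paper's standing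
assumption (abstract): "Let `E/ℚ` be an elliptic curve and `p > 2` be a prime of good ordinary
reduction for `E`. Assume that the residue representation associated with `(E, p)` is
irreducible"; the title restricts to non-CM curves).
The implication (2) ⇒ (3) for `r = 1` is proved there by descent over an imaginary quadratic `K`
(Friedberg–Hoffstein) from "`corank_{ℤ_p} Sel_{p^∞}(E/K) = 1` implies `ord_{s=1} L(E/K, s) = 1`",
which is also Burungale–Castella–Grossi–Skinner, Camb. J. Math. 14 (2026) = arXiv:2312.09301,
Cor. 1 (p. 4: "In the rank one case it yields a `p`-converse to the Gross–Zagier and Kolyvagin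
theorem: `corank_{ℤ_p} Sel_{p^∞}(E/K) = 1 ⟹ ord_{s=1} L(E/K, s) = 1`", for `p > 3` with (irr)).
Transcription, (2) ⇒ (3), `r = 1`, specialised to the hypotheses of crux `SelmerRankLB`: `W` a
globally minimal model (to read `a_p = W.frobeniusTrace p`); `5 ≤ p` (so `p ∤ 2`); good reduction
at `p` (so `p ∤ N`); `p ∤ a_p` (ordinary); `ρ̄_{E,p}` surjective (hence irreducible —
`hasIrreducibleModPGaloisRep_of_hasSurjectiveModNGaloisRep` — and `E` non-CM: for a CM curve
`ρ̄_{E,p}(G_ℚ)` normalises the image `⊆ (𝒪/p)ˣ` of the CM field's Galois group, so has order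
`≤ 2(p² − 1) < #GL₂(𝔽_p)` for `p ≥ 3`); `corank_{ℤ_p} Sel_{p^∞}(E/ℚ) =
W.selmerCorank p = 1`; conclusion `ord_{s=1} L(E, s) = W.analyticRank = 1`. Weaker than print;
unlike the tree's `burungaleSkinnerTianWan_analyticRank_eq_one_of_selmerCorank_eq_one`
(arXiv:2409.01350, Thm. 1.10) it carries no hypothesis (ram).
[cite: YanZhu2024MainConjNonCM, Cor. 1.4 (§1.1, held text p. 3) and Thm. 4.15 (§4.6, held text p. 12)]
[cite: BurungaleEtAl2026, Cor. 1 (arXiv:2312.09301, p. 4)]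
[file NumberTheory/EllipticCurves/BSDSelmerPConverseYanZhu] -/
def yanZhu_analyticRank_eq_one_of_selmerCorank_eq_one : Prop :=
  ∀ (W : WeierstrassCurve ℚ) [W.IsElliptic] [W.IsGloballyMinimal] (p : ℕ) [Fact p.Prime],
    5 ≤ p → W.HasGoodReductionAtPrime p → ¬ (p : ℤ) ∣ W.frobeniusTrace p →
    W.HasSurjectiveModNGaloisRep p → W.selmerCorank p = 1 → W.analyticRank = 1

/-- **Kim's structure theorem, corank clause, UPPER direction — the transcription faithful to the
printed PROOF: levels whose primes satisfy Kurihara's / Mazur–Rubin's cyclicity condition**, stated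
here as the conclusion of the (trivial) implication from the literal transcription
`Kim2022_selmerCorank_le_of_kuriharaNumber_ne_zero` (one hypothesis more: for every prime `ℓ ∣ n`,
the `p`-torsion `Ẽ(𝔽_ℓ)[p]` of the reduction has at most `p` elements, i.e. is `ℤ/p` or `0`,
i.e. `ℓ` does not split completely in `ℚ(E[p])`).
THE DISCREPANCY. C.-H. Kim (arXiv:2203.12159 = Amer. J. Math. (2026)), §1.2.2, defines
`𝒫_k = {ℓ : (ℓ, Np) = 1, ℓ ≡ 1 (mod p^k), a_ℓ(E) ≡ ℓ + 1 (mod p^k)}` with no further condition,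
and Thm. 1.9 is stated over the square-free products `𝒩_k` of such primes; the tree's
`Kato.IsKolyvaginPrime` / `IsKolyvaginProduct` and the fact above transcribe this literally. But:
(i) M. Kurihara (Münster J. Math. 7 (2014) = arXiv:1407.2465, §1.2 and §3.1: "`𝒫^{(N)} = {ℓ ∈
𝒫_good | ℓ ≡ 1 (mod p^N)}`", "`𝒫_1^{(N)} = {ℓ ∈ 𝒫^{(N)} | H⁰(𝔽_ℓ, E[p^N]) ≃ ℤ/p^N}`", `𝒩_1^{(N)}`
= square-free products of primes in `𝒫_1^{(N)}`), whose conjecture and numbers `δ̃_m`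
(`m ∈ 𝒩_1^{(N)}`) Thm. 1.9 is about, builds the cyclicity `H⁰(𝔽_ℓ, E[p^N]) ≃ ℤ/p^N` into the set
of levels; (ii) the proof of Thm. 1.9 is Mazur–Rubin's Kolyvagin-system theory ("We summarize some
materials in [mazur-rubin-book]", §2), whose primes of level `k` carry the condition
"`T/(p^k T + (Fr_ℓ - 1)T)` is free of rank one over `ℤ/p^k`" (B. Mazur–K. Rubin, *Kolyvagin
systems*, Mem. AMS 799 (2004), Def. 3.1.6, §3.5; verbatim in the paper whose notation Kim follows,
C.-H. Kim–M. Kim–H.-S. Sun, Selecta Math. 26 (2020), Def. 4.8, and in B. Mazur–K. Rubin, J. Théor.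
Nombres Bordeaux 28 (2016) = arXiv:1312.4052, Def. 9); (iii) Kim's own Thm. 2.1 (the
Euler-to-Kolyvagin-systems map) lists "`T/(Fr_ℓ - 1)T` is a cyclic `ℤ_p`-module for every
`ℓ ∈ 𝒫`" among its hypotheses, followed by "Under our working hypotheses, all the conditions in
Theorem 2.1 are satisfied" — true only once `𝒫` excludes the primes `ℓ` that split completely in
`ℚ(E[p])` (for those `Fr_ℓ = 1` on `E[p]`, so `T/(Fr_ℓ - 1)T ↠ E[p]` is not cyclic; they satisfy
`ℓ ≡ 1` and `a_ℓ ≡ 2 ≡ ℓ + 1 (mod p)`, hence lie in the literal `𝒫_1`, with density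
`1/#GL₂(𝔽_p) > 0` when `ρ̄` is onto). For `ℓ` in the literal `𝒫_k` the three conditions
"`Ẽ(𝔽_ℓ)[p^k] ≃ ℤ/p^k`" (Kurihara), "`T/(p^k T + (Fr_ℓ - 1)T)` free of rank one over `ℤ/p^k`"
(Mazur–Rubin) and "`#Ẽ(𝔽_ℓ)[p] ≤ p`" (here; = K. Ota's "`E(𝔽_ℓ)[p] ≃ ℤ/pℤ` or `0`", Amer. J.
Math. 140 (2018), Thm. 5.17) are equivalent: `Ẽ(𝔽_ℓ)[p^j] = E[p^j]^{Fr_ℓ = 1}` (good reduction at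
`ℓ ≠ p`), the characteristic polynomial of `Fr_ℓ` on `T/p^k` is `(X - 1)²`, and the cokernel of
`Fr_ℓ - 1` on `T/p^k` (whose determinant `1 - a_ℓ + ℓ` is `≡ 0 (mod p^k)`) is free of rank one
iff `Fr_ℓ ≢ 1 (mod p)` iff `dim E[p]^{Fr_ℓ = 1} = 1`, in which case `E[p^∞]^{Fr_ℓ = 1}` is cyclic
of order `≥ p^k`. Hence the printed proof establishes Thm. 1.9 (1) exactly at the levels all of
whose prime factors satisfy this condition, which is the statement below; at the other levels the
literal fact is stronger than what the source proves (it is consistent with the expected order of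
vanishing of Mazur–Tate elements and with the literature-prover's numerical evidence, but the
printed proof does not cover it). The levels `ν(n) < p` of the statement below follow from Ota's
theorem under Ota's hypotheses at `p`
(`Kim2022_selmerCorank_le_of_kuriharaNumber_ne_zero_of_otaStatement`, file
`KuriharaNumberKimStructureProofs`).
Tree form of the added hypothesis: for every prime `ℓ ∣ n`,
`Nat.card {P ∈ Ẽ(𝔽_ℓ) | p • P = 0} ≤ p` for the points of the reduction modulo `ℓ` of the minimal
model `WeierstrassCurve.integralModelInt W` (good reduction at `ℓ ∤ N_E`).
[cite: Kim2022StructureSelmer, Thm. 1.9 (1) (PDF p. 7), §1.2.2, Thm. 2.1 (§2.2)]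
[cite: Kurihara2014, §1.2 and §3.1 (definitions of 𝒫^{(N)}, 𝒫_1^{(N)}, 𝒩_1^{(N)})] [cite: KimKimSun2020, Def. 4.8] -/
theorem Kim2022_selmerCorank_le_of_kuriharaNumber_ne_zero_cyclicLevel_of
    (h : Kim2022_selmerCorank_le_of_kuriharaNumber_ne_zero) :
    ∀ (W : WeierstrassCurve ℚ) [W.IsElliptic] [W.IsGloballyMinimal] (p : ℕ) [Fact p.Prime],
    5 ≤ p → W.HasGoodReductionAtPrime p → ¬ (p : ℤ) ∣ W.frobeniusTrace p →
    W.HasSurjectiveModNGaloisRep p →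
    ∀ {N : ℕ} [NeZero N] (f : CuspForm (CongruenceSubgroup.Gamma0 N) 2),
    Literature.NumberTheory.EllipticCurves.ModularForms.IsNewformOf W f →
    (∃ u : ℚ, ‖(u : ℚ_[p])‖ = 1 ∧
      W.realPeriodRat = u * Literature.NumberTheory.EllipticCurves.ModularForms.plusPeriod f) →
    ∀ (k n : ℕ) [NeZero n], 1 ≤ k →
    Literature.NumberTheory.EllipticCurves.Kato.IsKolyvaginProduct W p k n →
    (∀ (ℓ : ℕ) [Fact ℓ.Prime], ℓ ∣ n →
      Nat.card {P : ((WeierstrassCurve.integralModelInt W).map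
          (Int.castRingHom (ZMod ℓ))).toAffine.Point // p • P = 0} ≤ p) →
    ∀ ψ : (ℓ : ℕ) → (ZMod ℓ)ˣ →* Multiplicative (ZMod (p ^ k)),
      (∀ ℓ ∈ n.primeFactors, Function.Surjective (ψ ℓ)) →
      Literature.NumberTheory.EllipticCurves.kuriharaNumber f (p ^ k) n ψ ≠ 0 →
      W.selmerCorank p ≤ n.primeFactors.card :=
  fun W _ _ p _ hp hgood hord hsurj _ _ f hf hper k n _ hk hn _ ψ hψ hne =>
    h W p hp hgood hord hsurj f hf hper k n hk hn ψ hψ hne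

/-- **PROOF-COVERED TWIN of `Kim2022_selmerCorank_le_of_kuriharaNumber_ne_zero` WITH
`E(ℚ_p)[p] = 0`** (ARM P D-audit, reader bsd-cited-r10, sheet `D-AUDIT-r10.md` sha16
cfa522325b7b7321 §D.2 F2 and its ADDENDUM-1 sha16 463fcb17390e3a71 §A3, 2026-08-26; typer
bsd-cited-ty2): the same statement —
C.-H. Kim, Amer. J. Math. 148 (2026), Thm. 1.8 (= arXiv:2203.12159 Thm. 1.9) (1), UPPER direction:
a certificate `δ̃_n^{(k)} ≠ 0` (`kuriharaNumber f (p^k) n ψ ≠ 0`) at a level `n ∈ 𝒩_k` gives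
`cork_{ℤ_p} Sel_{p^∞}(E/ℚ) = W.selmerCorank p ≤ ν(n)` — with ONE extra binder after the surjectivity
binder, `Nat.card {Q : (W.baseChange ℚ_[p]).toAffine.Point // (p : ℕ) • Q = 0} = 1`
(`t := ord_p #E(ℚ_p)[p^∞] = 0`; the shape of the `(t0)` binder of the clause-(6) twins in
`KuriharaNumberKimShaLengthLocalTorsionTrivial`, ⟺ `∀ P, (p : ℤ) • P = 0 → P = 0` by
`natCard_localPTorsion_eq_one_iff` there; at the good ordinary `p` of this statement it fails only
when `a_p ≡ 1 (mod p)` and `E(ℚ_p)` has a point of order `p`, Prop. 3.2 = journal Prop. 3.1).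
Under it the journal proof's `cork = ord(loc^s_p κ^Kato) = ord(p^t · δ̃)` (§5.3.3–5.3.4; Thm. 3.13
`x_n = u · p^t · δ̃_n`) reads `= ord(δ̃) ≤ ν(n)` directly, with no appeal to journal Lemma 3.12, so
the displayed argument covers a certificate of every depth `k ≥ 1` (see the FLAG on the literal fact
above). Same hypotheses otherwise (good ordinary `p ≥ 5`, `ρ̄` onto, period transfer, literal
`𝒩_k` — the CAVEAT on cyclic levels applies verbatim; the cyclic-level reading follows from this
twin exactly as `…_cyclicLevel_of` follows from the literal fact). Weaker than print; nothing
asserted; no `_holds` (size XL).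
[cite: Kim2022StructureSelmer, Thm. 1.9 (1) (PDF p. 7), §1.4.1–1.4.4 (PDF p. 7), Prop. 3.2 (PDF p. 15), Thm. 3.13 (PDF p. 17); journal (Amer. J. Math. 148 = arXiv v6) Thm. 1.8 (1), Prop. 3.1 (PDF p. 17), Thm. 3.11, Lemma 3.12 (PDF p. 21), §5.3.2–5.3.4 (PDF p. 29), §5.4.1 (PDF p. 30)]
[cite: AbbesUllmo1996, Thm. A] -/
def Kim2022_selmerCorank_le_of_kuriharaNumber_ne_zero_of_localTorsionTrivial : Prop :=
  ∀ (W : WeierstrassCurve ℚ) [W.IsElliptic] [W.IsGloballyMinimal] (p : ℕ) [Fact p.Prime],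
    5 ≤ p → W.HasGoodReductionAtPrime p → ¬ (p : ℤ) ∣ W.frobeniusTrace p →
    W.HasSurjectiveModNGaloisRep p →
    Nat.card {Q : (W.baseChange ℚ_[p]).toAffine.Point // (p : ℕ) • Q = 0} = 1 →
    ∀ {N : ℕ} [NeZero N] (f : CuspForm (CongruenceSubgroup.Gamma0 N) 2),
    Literature.NumberTheory.EllipticCurves.ModularForms.IsNewformOf W f →
    (∃ u : ℚ, ‖(u : ℚ_[p])‖ = 1 ∧
      W.realPeriodRat = u * Literature.NumberTheory.EllipticCurves.ModularForms.plusPeriod f) →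
    ∀ (k n : ℕ) [NeZero n], 1 ≤ k →
    Literature.NumberTheory.EllipticCurves.Kato.IsKolyvaginProduct W p k n →
    ∀ ψ : (ℓ : ℕ) → (ZMod ℓ)ˣ →* Multiplicative (ZMod (p ^ k)),
      (∀ ℓ ∈ n.primeFactors, Function.Surjective (ψ ℓ)) →
      Literature.NumberTheory.EllipticCurves.kuriharaNumber f (p ^ k) n ψ ≠ 0 →
      W.selmerCorank p ≤ n.primeFactors.card

/-- Bridge: the literal fact implies its `(t0)` twin (one more hypothesis). Proved.
[cite: Kim2022StructureSelmer, Thm. 1.9 (1) (PDF p. 7)] -/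
theorem Kim2022_selmerCorank_le_of_kuriharaNumber_ne_zero_of_localTorsionTrivial_of
    (h : Kim2022_selmerCorank_le_of_kuriharaNumber_ne_zero) :
    Kim2022_selmerCorank_le_of_kuriharaNumber_ne_zero_of_localTorsionTrivial :=
  fun W _ _ p _ hp hgood hord hsurj _ _ _ f hf hper k n _ hk hn ψ hψ hne =>
    h W p hp hgood hord hsurj f hf hper k n hk hn ψ hψ hne

end Literature.NumberTheory.EllipticCurves
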